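import Mathlib

/-!
# PercRepro — the profile arithmetic of the CodeBound8 hand proof (typer-2, gen 5)

p4 (`proofs/P4-seven.md` §9.1 (c)): with `h(m) = 1, 2, 3, 3, 4, 4` the dimension lower bound of a type with
`m` members (`m = 1..6`; `h(0) = 0`) and every type of size `≤ 6` (Kleitman), the (D) bound
`h(p) + h(q) + h(r) ≤ 7` forces `p + q + r ≤ 9`: every profile with `p + q + r ≥ 10` has `h(p) + h(q) + h(r) ≥ 8`.
Pure arithmetic, decided.

* `hrank` — the table `0, 1, 2, 3, 3, 4, 4` (values at `m ≥ 7` irrelevant here);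
* **`profile_le_nine`** — `1 ≤ p, q, r ≤ 6 → hrank p + hrank q + hrank r ≤ 7 → p + q + r ≤ 9` (`profile_le_nine_fin`:
  343 cases over `Fin 7`, decided; WITHOUT the nonemptiness `1 ≤ p, q, r` the claim is FALSE — `(6, 4, 0)`: `decide`
  found it — so the code axiom «all three colour pairs occur» is load-bearing);
* **`code_card_le_of_profile`** — the assembly: `|C| = 2·(p + q + r)`, the three sizes `≤ 6`, the rank bounds
  `h(p) ≤ d_X` etc. and `d_X + d_Y + d_Z ≤ 7` give `|C| ≤ 18`.
-/

namespace PercRepro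

/-- The dimension lower bound `h(m)` of a type with `m` members: `0, 1, 2, 3, 3, 4, 4` for `m = 0, …, 6`. -/
def hrank : ℕ → ℕ
  | 0 => 0
  | 1 => 1
  | 2 => 2
  | 3 => 3
  | 4 => 3
  | 5 => 4
  | _ => 4

/-- **The profile arithmetic**: three types of size `≤ 6` whose rank bounds sum to `≤ 7` have at most `9`
members in all (decided over the `7³` profiles). -/
theorem profile_le_nine_fin : ∀ p q r : Fin 7, 1 ≤ (p : ℕ) → 1 ≤ (q : ℕ) → 1 ≤ (r : ℕ) →
    hrank p + hrank q + hrank r ≤ 7 → (p : ℕ) + q + r ≤ 9 := by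
  decide

/-- The profile arithmetic on natural numbers. The lower bounds `1 ≤ p, q, r` are NECESSARY (the profile
`(6, 4, 0)` has `h`-sum `7` and `10` members): they come from the code axiom «all three colour pairs occur on
complementary pairs», i.e. every type is nonempty. -/
theorem profile_le_nine (p q r : ℕ) (hp1 : 1 ≤ p) (hq1 : 1 ≤ q) (hr1 : 1 ≤ r) (hp : p ≤ 6) (hq : q ≤ 6)
    (hr : r ≤ 6) (h : hrank p + hrank q + hrank r ≤ 7) : p + q + r ≤ 9 :=
  profile_le_nine_fin ⟨p, by omega⟩ ⟨q, by omega⟩ ⟨r, by omega⟩ hp1 hq1 hr1 h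

/-- **The assembly of CodeBound8 from its pieces**: if `|C| = 2·(p + q + r)` (`card_eq_two_mul_types`), the
three type sizes are `1 ≤ · ≤ 6` (every type occurs; Kleitman), the type dimensions `d_X, d_Y, d_Z` satisfy `hrank p ≤ d_X` etc.
(piece (H)) and `d_X + d_Y + d_Z ≤ 7` (piece (D)), then `|C| ≤ 18`. -/
theorem code_card_le_of_profile {c p q r dX dY dZ : ℕ} (hc : c = 2 * (p + q + r))
    (hp1 : 1 ≤ p) (hq1 : 1 ≤ q) (hr1 : 1 ≤ r)
    (hp : p ≤ 6) (hq : q ≤ 6) (hr : r ≤ 6) (hX : hrank p ≤ dX) (hY : hrank q ≤ dY) (hZ : hrank r ≤ dZ)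
    (hD : dX + dY + dZ ≤ 7) : c ≤ 18 := by
  have := profile_le_nine p q r hp1 hq1 hr1 hp hq hr (by omega)
  omega

end PercRepro
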